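import Summits.QuantumFields.YangMills.Theorems.BalabanUVNodesN26AtRecord12B13Family
import Literature.MathematicalPhysics.QuantumFieldTheory.Balaban1983to89.Beta.RemainderData190TowerFlat

/-!
# DAG node N26 — THE (D4)-CHAIN, THE ROWS-(D4) ∧ B4 RESIDUE AND CRUX K2′'s REGISTERED STUB `D4AtSlopeOfD1Record12` AT θ FROM THE RECORD's [B13] FAMILY OF RECORD
# WITH NODE D's (190)-DATUM SUPPLIED, LETTER-FREE, BY NE9's FLAT TOWER OPERATOR `H₁,k(1)` ON THE MEMBERS' OWN TORI — the family form (`h22`-free, letters of record)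
# of the row-(D4) owner's `…N26AtBetaOfRecord11B13LayersTowerFlat` (p478107): dag-n26-c's `…N26AtRecord12B13Family` (p478229) with its displayed `(Wn, instW, instWs, D)`
# group CONSTRUCTED by «Y19» `Beta.RemainderData190TowerFlat.exists_data190_tower_flat` at `N := NOfLayers (m ↦ lamF (Ps k v m) k v)`

Cell pub-balaban, β-function sub-cell, BINDER row (D4) OWNER lineage `b2b-balaban-beta-an4` (gen 125; memo `HOME/b2b-balaban-beta-an4/FLAT-LETTERS-LOCATED.md` §36;
pub-ymgap bus: dag-n26-c g4 LANDED-2 «your TowerFlat NODE-D supply composes with this module member-wise — `D k v` here is your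
`Data190 4 M (NOfLayers fun m => lamF (Ps k v m) k v) (Wn k v) q`», an4 g125 LANDED-1 «I will write that one-line family form ON TOP of yours»).

WHY THIS FILE.  p478229 (dag-n26-c g4, over node00-def-B13's `Node00.Record12CarriersB13Family` p476387 and the row-(D4) owner's adapter) reads the (D4) chain at the
Stage-12 view's split along RUN SEQUENCES AT FIXED HISTORY through the record's history-indexed [B13] family `lamF : ResidB13Fam₁₂ F N θ`, with N10's in-edge in the
FAMILY currency, the chain's constants = THE LETTERS OF RECORD `c13OfRecord₁₂ F N θ c₀` (N2's `h22` discharged), and every per-member hypothesis asked on the box only —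
but, like p468083, with the (190)-side datum `D k v : Data190 4 M (NOfLayers (m ↦ lamF (Ps k v m) k v)) (Wn k v) q` on ARBITRARY (4.4)-spaces `Wn k v` as a DISPLAYED
binder.  p478107 (this lineage, same gen) showed that «Y19» `exists_data190_tower_flat` — NE9's flat tower operator `H₁,k(1)`, the (190)-socket inhabited on the fine bond
fields of the (k+1)-storey tower over ANY exhausting torus sequence, letter-free, (4.35) rule exposed — inhabits that binder BY TYPE at the members' tori.  THIS FILE is the
one-line family form: §1 `exists_chainTFac190H_view_of_family_towerFlat` — `∃ (δ⋆, C⋆)` FIRST, then for every family of tower weights per scale, cube side, size indices,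
block-geometry letters, source direction ∕ value, `q` under numerics only, every Stage-12 tuple `θ`, run `p`, residual letters `c₀`, family `lamF`, box `γ₀ ≤ θ.γ`, leaf kernels
with the (1.22) identification at the view, the member letters law and N10's family leaf of record, run sequences `Ps k v` with growing tori ∕ laws ∕ restriction sentences on
the box, N1 ∕ N3 at the letters of record, ANY admissible regularity display ∕ positivity witness of `Δ_{a,k}(1)` per (k, v, m), the (4.4) seams FROM THE TOWER's FINE BOND
FIELDS over the members' tori with the members' activities holomorphic along them, and the (1.7) data with the test-vector limit `hconv` READ ON THE EXPLICIT FLAT VECTORS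
`b ↦ [unit-lattice site below b ∈ a cube of Ȳ] ? (H₁,k(1))ᵉ(δ_{(ê x, μ₀)}·w₀)(b) : 0` (on the box): (i) the chain `∃ R : ChainTFac190H 4 M μ ν (oneLoopSplitOfRecord₁₁ F N
(θ.toStage11 F N p)) γ₀ (c13OfRecord₁₂ F N θ c₀) (L∕2) α₂ q` with `R.A1 = A1` and per (k, v) in the box the tori handle (`Eq`) and the steps handle (`HEq`), the
carriers being the tower's fine bond fields BY THE STATEMENT; (ii) the rows-(D4) ∧ B4 residue `AtSlopeCont … γ₀ s` (`h22`-free); (iii) B4 at the view's β of record;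
(iv) **crux K2′'s registered stub `stub_d4AtSlopeCont12 : D4AtSlopeOfD1Record12` AT θ in the stub's own letters** (p478229's `d4AtSlopeOfD1Record12_at_of_family`) — now
⇐ the record's family leaf + letters law + run sequences ∕ laws ∕ `Restr` + N1 ∕ N3 at the letters of record + NE9's tower structure data and numerics + the seams and
(1.7) data on the tower carriers + (1.22) + the one-loop slope + (C-pt): NODE D no longer displayed.  A REDUCTION of the stub at θ, NOT a proof of it.

HONEST FRAMING.  Composition BY NAME (0 `def`, 0 `sorry`; one `choose` over «Y19» per (k, v) and p478229's four theorems); NO estimate is proved here and nothing of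
Bałaban's is constructed beyond NE9's flat tower operator.  NODE D on «Y19»'s MODEL CLASS exactly as in p478107 — zero background (`□₀ = 1`, `Δ⁽²⁾(1) = 0`), the
one-domain tower `Ω_k = T_η` of height k+1 over the member's coarse torus, the VALUE line of (190) only, ONE unit source per unit-lattice site; whether Bałaban's (4.35) test
vectors of the record's (k+1)-st step ARE these is def-T's term tower of record (absent) — NOT asserted.  STILL DISPLAYED: the run sequences with growing tori AT FIXED HISTORY
(NODE O ∕ 00 — the record family carries one member per (run, k, v)), N10's FAMILY leaf of record + the member letters law (NODE A in the family currency = N10's own discharge,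
0∕1), the laws and restriction sentences, the (4.4) seams from the tower's bond fields + activities holomorphy (NODE B), the (1.7) ∕ (1.21) data (NODE E), the (1.22)
identification `hm`, (C-pt), N1 ∕ N3 at the letters of record, the one-loop slope.  (D4) INSTANCE 0∕1, D4 DISCHARGE NO DATE; `stub_d4AtSlopeCont12` NOT proved; N10 ∕ N25 ∕
N26 NOT discharged; counts unmoved.  One finite four-torus programme at fixed ε per run — NOT the continuum limit, NOT ℝ⁴, NOT infinite volume, NOT OS, NOT a mass gap,
NOT Clay.  No `instance`, no `notation`, no `axiom`.
Sources (context): [I] = [Balaban1987RG1] CMP **109** (1987): Thm 3 p. 264, (1.7) p. 261, (1.20)–(1.22) p. 264, (2.12)–(2.13) p. 268, (4.4) p. 281, p. 282, (4.35) p. 290,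
(5.10) p. 293; [II] = [Balaban1988RG2Cluster] CMP **116** (1988): (2.13) p. 14, p. 15, Lemma 3 (2.38) p. 20, p. 21; [15] = [Balaban1985Variational] CMP **102** (1985):
(129)–(130) p. 297, (190) p. 308; [5] = [Balaban1985BackgroundPropagators] CMP **99** (1985): (3.126) p. 420, (3.133)–(3.134) p. 422, Thm 3.11 p. 416;
[3] = [Balaban1984PropagatorsII] CMP **96** (1984): (1.103) p. 36, Lemma 2.1 (2.61) p. 234.
-/

noncomputable section

open scoped Matrix.Norms.L2Operator InnerProductSpace ComplexConjugate

namespace Summit.QuantumFields.YangMills.Theorems.BalabanUVNodesN26AtRecord12B13FamilyTowerFlat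

open Literature.MathematicalPhysics.QuantumFieldTheory.Balaban1983to89
open Literature.MathematicalPhysics.QuantumFieldTheory.Balaban1983to89.FlowStep
open Literature.MathematicalPhysics.QuantumFieldTheory.Balaban1983to89.T4Continuum (T4Family)
open Literature.MathematicalPhysics.QuantumFieldTheory.Balaban1983to89.Node00
open Literature.MathematicalPhysics.QuantumFieldTheory.Balaban1983to89.B13ScaleTransfer (Pt)
open Literature.MathematicalPhysics.QuantumFieldTheory.Balaban1983to89.TreeLengthTorus (TPt TDom proj)
open Literature.MathematicalPhysics.QuantumFieldTheory.Balaban1983to89.B4Sect5Torus (TSite)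
open Literature.MathematicalPhysics.QuantumFieldTheory.Balaban1983to89.B12Decay510 (mixedDeriv)
open Literature.MathematicalPhysics.QuantumFieldTheory.Balaban1983to89.B12Decay510Torus (tcubeOf)
open Literature.MathematicalPhysics.QuantumFieldTheory.Balaban1983to89.B9SectCLatticeCarrier (Bond bpos)
open Literature.MathematicalPhysics.QuantumFieldTheory.Balaban1983to89.B9Eq311L2Pairing (WL2)
open Literature.MathematicalPhysics.QuantumFieldTheory.Balaban1983to89.B9Eq315QTower (towerP UlevOf)
open Literature.MathematicalPhysics.QuantumFieldTheory.Balaban1983to89.B9Eq315QTorus (perCfg cornerSite)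
open Literature.MathematicalPhysics.QuantumFieldTheory.Balaban1983to89.B9Eq319QprimeTorus (blockCoord)
open Literature.MathematicalPhysics.QuantumFieldTheory.Balaban1983to89.B9Eq316TowerFlatIsOneStep (siteCast towerP_eq_fineP_pow)
open Literature.MathematicalPhysics.QuantumFieldTheory.Balaban1983to89.B7Prop1Explicit (U1 Wcx boxVec)
open Literature.MathematicalPhysics.QuantumFieldTheory.Balaban1983to89.B7Prop2Explicit (c2')
open Literature.MathematicalPhysics.QuantumFieldTheory.Balaban1983to89.B11Eq103H1Complex (BondL2K)
open Literature.MathematicalPhysics.QuantumFieldTheory.Balaban1983to89.B9Eq326OperatorTower (laplaceAk H1k)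
open Literature.MathematicalPhysics.QuantumFieldTheory.Balaban1983to89.Beta.RemainderChainLattice
open Literature.MathematicalPhysics.QuantumFieldTheory.Balaban1983to89.Beta.RemainderLimitTorus (LDom limKernel tproj)
open Literature.MathematicalPhysics.QuantumFieldTheory.Balaban1983to89.Beta.RemainderDecay190 (Consts190 Data190)
open Literature.MathematicalPhysics.QuantumFieldTheory.Balaban1983to89.Beta.RemainderDecay190HoloChain (ChainTFac190H)
open Literature.MathematicalPhysics.QuantumFieldTheory.Balaban1983to89.Beta.RemainderWOfRecordB13 (SpLaw Law213 NOfLayers)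
open Literature.MathematicalPhysics.QuantumFieldTheory.Balaban1983to89.Beta.RemainderData190TowerFlat (exists_data190_tower_flat)
open Summit.QuantumFields.BalabanUV.Gaps
open Summit.QuantumFields.BalabanUV.Gaps.BetaContFromD4Chain
open Summit.QuantumFields.YangMills.Theorems.BalabanUVNodesN26AtRecord12B13Family
  (exists_chainTFac190H_view_of_family atSlopeCont_view_of_family betaContH_view_of_family d4AtSlopeOfD1Record12_at_of_family)
open Metric Filter Topology

variable (F : T4Family) (N : ℕ) [NeZero N]

/-! ## §1 The family form: p478229's four readings with NODE D := NE9's flat tower operator on the members' tori («Y19» at `N := NOfLayers (m ↦ lamF (Ps k v m) k v)`) -/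

section FamilyTowerFlat

-- NE9's tower structure data ([5] §3 ∕ [15]: block size `L ≥ 3`, the C⋆-algebra `𝔸`, its Hilbert model `W ≃ 𝔸`, the trace `τ`, `a, a′, ρ_w, A_Q`)
variable (L : ℕ) [NeZero L] (hL : 1 ≤ L) (hL3 : 3 ≤ L)
  {𝔸 : Type*} [CStarAlgebra 𝔸] [Nontrivial 𝔸]
  {W : Type} [NormedAddCommGroup W] [InnerProductSpace ℂ W] [FiniteDimensional ℂ W] (φ : W ≃ₗ[ℂ] 𝔸)
  {Mφ Mφ' : ℝ} (hMφ : 0 ≤ Mφ) (hMφ' : 0 ≤ Mφ') (hφ : ∀ w, ‖φ w‖ ≤ Mφ * ‖w‖) (hφ' : ∀ X, ‖φ.symm X‖ ≤ Mφ' * ‖X‖)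
  {a₁ : ℝ} (ha₁ : 0 < a₁) {a₁' : ℝ} (ha₁' : 0 < a₁')
  (τ : 𝔸 →ₗ[ℂ] ℂ) {Cτ : ℝ} (hτ : ∀ X, ‖τ X‖ ≤ Cτ * ‖X‖) (hCτ : 0 ≤ Cτ) {Mτ : ℝ}
  (hτm : ∀ X Y : 𝔸, ‖τ (X * Y)‖ ≤ Mτ * ‖X‖ * ‖Y‖) (hMτ : 0 ≤ Mτ) {ρw : ℝ} (hρw : 0 ≤ ρw)
  (hτ₁ : ∀ X : 𝔸, τ (star X) = conj (τ X)) (hτ₂ : ∀ X Y : 𝔸, τ (X * Y) = τ (Y * X))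
  (hφτ : ∀ X Y : 𝔸, ⟪φ.symm X, φ.symm Y⟫_ℂ = τ (star X * Y))
  (AQ : ℝ) (hAQ16 : 16 * (((4 : ℕ) : ℝ) + 1) * (((4 : ℕ) : ℝ) + 4) * c2' 4 L ≤ AQ)

include hL3 hMφ hMφ' hφ hφ' ha₁ ha₁' hτ hCτ hτm hMτ hρw hτ₁ hτ₂ hφτ hAQ16

/-- **THE (D4)-CHAIN, THE RESIDUE, B4 AND K2′'s STUB AT θ FROM THE RECORD's [B13] FAMILY WITH NODE D SUPPLIED BY NE9's FLAT TOWER OPERATOR ON THE MEMBERS' TORI**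
(«Y19» `exists_data190_tower_flat` at `N := NOfLayers (m ↦ lamF (Ps k v m) k v)` plugged into p478229's `exists_chainTFac190H_view_of_family` ∕ `atSlopeCont_view_of_family` ∕
`betaContH_view_of_family` ∕ `d4AtSlopeOfD1Record12_at_of_family`).  `∃ (δ⋆, C⋆)` FIRST (functions of NE9's structure data only); then for every family of tower weights per
scale (`η_k L^{k+1} = 1`, `c₀(k) (L^{k+1})⁴ = c₁(k)`, `|η_k|⁴∕c₀(k) ≤ ρ_w`), cube side `M`, size index set `I ∋ i₀`, block-torus geometry letters, source direction `μ₀` and value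
`w₀`, every `q : Consts190` under NUMERICS ONLY (`0 < q.σ`, `c₀(δr, q.σ∕δr)⁴ ≤ q.cR`, `1 ≤ q.κB`, `q.δ15 ≤ δ⋆`, `C⋆ ≤ q.Cst`, `‖w₀‖ ≤ q.m`, `q.θ ≤ 1`), every Stage-12 tuple
`θ`, run `p`, residual letters `c₀`, history-indexed family `lamF : ResidB13Fam₁₂ F N θ`, box `γ₀ ≤ θ.γ`, leaf kernels `A1` with the (1.22) identification at the view, the member
letters law `hcF` and N10's FAMILY leaf of record `hleafF`, run sequences `Ps k v` with growing tori ∕ laws ∕ restriction sentences on the box, N1 ∕ N3 at the letters of record,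
ANY admissible regularity display `(αU, hα1, hαL, hU1, hreg)` and positivity witness `hpos` of `Δ_{a,k}(1)` per (k, v, m) («Y19» §1 derives one; the operator does not depend on
the choice, «Y12c»), every (4.4) seam `emb k v m X` FROM THE FINE BOND FIELDS OF THE (k+1)-STOREY TOWER OVER THE UNIT TORUS OF SIDE `((lamF (Ps k v m) k v).n+1)·M` into the
member's `sp2 X` with the member's activities holomorphic along it (on the box), and (1.7) data `V, Fw, r, hfac, t` with the test-vector limit `hconv` READ ON THE EXPLICIT FLAT
VECTORS `b ↦ [unit-lattice site below b ∈ a cube of Ȳ] ? (H₁,k(1))ᵉ(δ_{(ê x, μ₀)}·w₀)(b) : 0` and the read-out `ha` (on the box):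
(i) `∃ R : ChainTFac190H 4 M μ ν (oneLoopSplitOfRecord₁₁ F N (θ.toStage11 F N p)) γ₀ (c13OfRecord₁₂ F N θ c₀) (L∕2) α₂ q` with `R.A1 = A1` and, per (k, v) in the box, the tori
handle `(R.leaves k v hv).N = m ↦ (lamF (Ps k v m) k v).n + 1` and the steps handle `(R.leaves k v hv).W ≍ m ↦ (WtOfRecord θ₃ (lamF (Ps k v m) k v)).toTorusStep`
(p478229's handles; the carriers `Wn k v m = Bond 4 (towerP …) → W` are fixed BY THE STATEMENT — the seams `emb` and restrictions `r` are typed on them); (ii) with `Valid`,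
smallness `ε₁·K_rem,L ≤ s` and (C-pt):
`AtSlopeCont (oneLoopSplitOfRecord₁₁ F N (θ.toStage11 F N p)) γ₀ s` (`h22`-free); (iii) with `Valid` and (C-pt): `BetaContH γ₀ (betaOfRecord₁₁ F N (θ.toStage11 F N p))`;
(iv) with `0 < γ₀`, `Valid`, the one-loop slope `ε₁·K_rem,L ≤ stepBal Nc Lc` and (C-pt): CRUX K2′'s REGISTERED STUB `D4AtSlopeOfD1Record12`'s body AT `(F, θ)` in the stub's own
letters, `∃ γ₁, 0 < γ₁ ∧ γ₁ ≤ θ.γ ∧ AtSlopeCont (oneLoopSplit_betaOfMerged (betaMerged F ℰ_θ θ.ρ8 θ.bV) (beta0OfMerged … θ.v₀) θ.γ) γ₁ (stepBal Nc Lc)` — a REDUCTION of the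
stub at θ with NODE D no longer displayed, NOT a proof of it.  NODE D on «Y19»'s MODEL class (zero background, one-domain tower, value line, one source direction); every other
input displayed; instance 0∕1.
[cite: Balaban1985Variational, (129)–(130) p.297, (190) p.308] [cite: Balaban1985BackgroundPropagators, (3.126) p.420, (3.133)–(3.134) p.422, Thm 3.11 p.416]
[cite: Balaban1984PropagatorsII, (1.103) p.36, Lemma 2.1 (2.61) p.234] [cite: Balaban1987RG1, Thm 3 p.264, (1.7) p.261, (1.20)-(1.22) p.264, (2.12)-(2.13) p.268, (4.4) p.281, p.282, (4.35) p.290, (5.10) p.293]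
[cite: Balaban1988RG2Cluster, (2.13) p.14, p.15, Lemma 3 (2.38) p.20 and p.21] -/
theorem exists_chainTFac190H_view_of_family_towerFlat :
    ∃ δs Cs : ℝ, 0 < δs ∧ 0 ≤ Cs ∧
      ∀ -- tower weights per scale `k` (height `k + 1`)
        (η : ℕ → ℝ) (_hηL : ∀ k, η k * (L : ℝ) ^ (k + 1) = 1) (c₀ c₁ : ℕ → ℝ) [∀ k, Fact (0 < c₀ k)] [∀ k, Fact (0 < c₁ k)]
        (_hw : ∀ k, c₀ k * ((L : ℝ) ^ (k + 1)) ^ 4 = c₁ k) (_hρ : ∀ k, |η k| ^ 4 / c₀ k ≤ ρw)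
        -- cube side, size indices, block-geometry letters, source direction ∕ value, the (190)-record under numerics only
        (M : ℕ) [NeZero M] (I : Type) (_i₀ : I) (η₀ L₀ M₀ Rg : ℕ → ℝ) (Hg : ℕ → Prop) (μ₀ : Fin 4) (w₀ : W)
        (q : Consts190) (δr : ℝ) (_hδr : 0 < δr) (_hσ₀ : 0 < q.σ) (_hcR : B6.c0 δr (q.σ / δr) ^ 4 ≤ q.cR) (_hκB : 1 ≤ q.κB)
        (_hδ15 : q.δ15 ≤ δs) (_hCst : Cs ≤ q.Cst) (_hmw : ‖w₀‖ ≤ q.m) (_hθ1 : q.θ ≤ 1)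
        -- the Stage-12 tuple, a run, the residual letters, the record's [B13] FAMILY, the box, the leaf kernels with the (1.22) identification at the view
        (γ₀ : ℝ) (μ ν : Fin 4) (α₂ : ℝ) (θ : Stage12Params F N) (p : B12.RunParams) (cR : B13.Consts) (lamF : ResidB13Fam₁₂ F N θ)
        (_hle : γ₀ ≤ θ.γ) (A1 : (k : ℕ) → (Fin (k + 1) → ℝ) → LDom 4 → Pt 4 → ℝ)
        (_hm : ∀ k (v : Fin (k + 1) → ℝ), v ∈ Box γ₀ k →
          betaMergedOfRecord₁₁ F N (θ.toStage11 F N p) k v =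
            beta0OfRecord₁₁ F N (θ.toStage11 F N p) k + B12Beta.secondMoment (fun _ _ => limKernel (A1 k v)) μ ν)
        -- N10's in-edge in the FAMILY currency at every run, and the member letters law on the box
        (_hcF : ∀ P k v, v ∈ Box γ₀ k → (lamF P k v).c = c13OfRecord₁₂ F N θ cR)
        (_hleafF : ∀ P, B13FamLeafOfRecord₁₂ F N θ cR lamF P)
        -- per (scale, history) IN THE BOX: a RUN SEQUENCE whose members AT THAT HISTORY have growing coarse tori, their laws and restriction sentences
        (Ps : (k : ℕ) → (Fin (k + 1) → ℝ) → ℕ → B12.RunParams)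
        (_hn : ∀ k v, v ∈ Box γ₀ k → Tendsto (fun m => (lamF (Ps k v m) k v).n) atTop atTop)
        (_hsp : ∀ k v, v ∈ Box γ₀ k → ∀ m, SpLaw (lamF (Ps k v m) k v))
        (_h213 : ∀ k v, v ∈ Box γ₀ k → ∀ m, Law213 (lamF (Ps k v m) k v))
        (_hR : ∀ k v, v ∈ Box γ₀ k → ∀ m, (lamF (Ps k v m) k v).Restr)
        -- N1 ∕ N3 at the LETTERS OF RECORD and ℓ = ½L
        (_hC : CondsL 4 (c13OfRecord₁₂ F N θ cR) (((c13OfRecord₁₂ F N θ cR).L : ℝ) / 2)) (_hs : SignsL (c13OfRecord₁₂ F N θ cR) α₂ q.B₃)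
        -- ANY admissible regularity display and positivity witness of `Δ_{a,k}(1)` per (k, v, m) on the tower over the member's torus
        (αU : (k : ℕ) → (Fin (k + 1) → ℝ) → ℕ → ℕ → ℝ) (hα1 : ∀ k v m j, αU k v m j ≤ 1 / 64)
        (hαL : ∀ k v m j, 50 * (((4 : ℕ) : ℝ) + 1) * αU k v m j * (L : ℝ) ^ 4 ≤ 1 / 2)
        (hU1 : ∀ k v m (j : ℕ) (z : B7Prop1Explicit.Site 4) (κ : Fin 4),
          perCfg (towerP L (fun _ : Fin 4 => NOfLayers (fun m => lamF (Ps k v m) k v) m * M) (j + 1))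
            (UlevOf L (fun _ : Fin 4 => NOfLayers (fun m => lamF (Ps k v m) k v) m * M) (k + 1) (fun _ => (1 : 𝔸ˣ)) j) z κ ∈ U1 𝔸)
        (hreg : ∀ k v m (j : ℕ) (y : TSite 4 (towerP L (fun _ : Fin 4 => NOfLayers (fun m => lamF (Ps k v m) k v) m * M) j)) (κ : Fin 4)
          (ρ' : Fin 4 → Fin L),
          ‖((Wcx L (perCfg (towerP L (fun _ : Fin 4 => NOfLayers (fun m => lamF (Ps k v m) k v) m * M) (j + 1))
              (UlevOf L (fun _ : Fin 4 => NOfLayers (fun m => lamF (Ps k v m) k v) m * M) (k + 1) (fun _ => (1 : 𝔸ˣ)) j))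
              (cornerSite L y) κ (boxVec L ρ') : 𝔸ˣ) : 𝔸) - 1‖ ≤ αU k v m j)
        (hpos : ∀ k v m (u : BondL2K ℂ 4 (towerP L (fun _ : Fin 4 => NOfLayers (fun m => lamF (Ps k v m) k v) m * M) (k + 1)) (c₀ k) W), u ≠ 0 →
          0 < RCLike.re ⟪u, laplaceAk L (fun _ : Fin 4 => NOfLayers (fun m => lamF (Ps k v m) k v) m * M) k φ (η k) (fun _ => (1 : 𝔸ˣ)) hL
            (αU k v m) (hα1 k v m) (hU1 k v m) (hreg k v m) τ (c₀ := c₀ k) (c₁ := c₁ k) a₁ u⟫_ℂ)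
        -- the (4.4) seams FROM THE TOWER's FINE BOND FIELDS into the members' spaces p. 15, the members' ACTIVITIES holomorphic along them (on the box)
        (emb : (k : ℕ) → (v : Fin (k + 1) → ℝ) → (m : ℕ) → TDom 4 ((lamF (Ps k v m) k v).n + 1) → (Bond 4 (towerP L (fun _ : Fin 4 => NOfLayers (fun m => lamF (Ps k v m) k v) m * M) (k + 1)) → W) → (lamF (Ps k v m) k v).Φ)
        (_hemb : ∀ k v, v ∈ Box γ₀ k → ∀ m X, ∀ u ∈ ball (0 : Bond 4 (towerP L (fun _ : Fin 4 => NOfLayers (fun m => lamF (Ps k v m) k v) m * M) (k + 1)) → W) α₂, emb k v m X u ∈ (lamF (Ps k v m) k v).sp2 X)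
        (_hH : ∀ k v, v ∈ Box γ₀ k → ∀ m (X Z : TDom 4 ((lamF (Ps k v m) k v).n + 1)), Z.1 ⊆ X.1 →
          DifferentiableOn ℂ (fun u => (lamF (Ps k v m) k v).H Z (emb k v m X u)) (ball 0 α₂))
        -- the (1.7) ∕ test-vector-limit data (on the box), the limit READ ON THE EXPLICIT FLAT TEST VECTORS, and the read-out of the leaf kernels
        (V : (k : ℕ) → (Fin (k + 1) → ℝ) → LDom 4 → Type) (_instV : ∀ k v Y, NormedAddCommGroup (V k v Y))
        (_instVs : ∀ k v Y, NormedSpace ℂ (V k v Y))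
        (Fw : (k : ℕ) → (v : Fin (k + 1) → ℝ) → (Y : LDom 4) → V k v Y → ℂ)
        (_hFd : ∀ k v, v ∈ Box γ₀ k → ∀ Y, ∃ ρ > 0, DifferentiableOn ℂ (Fw k v Y) (ball 0 ρ))
        (r : (k : ℕ) → (v : Fin (k + 1) → ℝ) → (m : ℕ) → (Y : LDom 4) → (Bond 4 (towerP L (fun _ : Fin 4 => NOfLayers (fun m => lamF (Ps k v m) k v) m * M) (k + 1)) → W) →L[ℂ] V k v Y)
        (_hfac : ∀ k v, v ∈ Box γ₀ k → ∀ Y : LDom 4, ∀ᶠ m in atTop, ∀ u ∈ ball (0 : Bond 4 (towerP L (fun _ : Fin 4 => NOfLayers (fun m => lamF (Ps k v m) k v) m * M) (k + 1)) → W) α₂,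
          (lamF (Ps k v m) k v).Ek1 (tproj ((lamF (Ps k v m) k v).n + 1) Y) (emb k v m (tproj ((lamF (Ps k v m) k v).n + 1) Y) u) = Fw k v Y (r k v m Y u))
        (t : (k : ℕ) → (v : Fin (k + 1) → ℝ) → (Y : LDom 4) → Pt 4 → V k v Y)
        (_hconv : ∀ k v, v ∈ Box γ₀ k → ∀ (Y : LDom 4) (x : Pt 4),
          Tendsto (fun m => r k v m Y
            (fun b : Bond 4 (towerP L (fun _ : Fin 4 => NOfLayers (fun m => lamF (Ps k v m) k v) m * M) (k + 1)) =>
              if tcubeOf (NOfLayers (fun m => lamF (Ps k v m) k v) m) M (fun i => ((blockCoord (L ^ (k + 1)) (fun _ : Fin 4 => NOfLayers (fun m => lamF (Ps k v m) k v) m * M)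
                    (siteCast (towerP_eq_fineP_pow L (fun _ : Fin 4 => NOfLayers (fun m => lamF (Ps k v m) k v) m * M) (k + 1)) (bpos b)) i : ℕ) :
                      ZMod (NOfLayers (fun m => lamF (Ps k v m) k v) m * M))) ∈ (tproj ((lamF (Ps k v m) k v).n + 1) Y).1 then
                ((WL2.linearEquiv ℂ ℂ (fun _ : Bond 4 (towerP L (fun _ : Fin 4 => NOfLayers (fun m => lamF (Ps k v m) k v) m * M) (k + 1)) => c₀ k) :
                    BondL2K ℂ 4 (towerP L (fun _ : Fin 4 => NOfLayers (fun m => lamF (Ps k v m) k v) m * M) (k + 1)) (c₀ k) W ≃ₗ[ℂ] (Bond 4 (towerP L (fun _ : Fin 4 => NOfLayers (fun m => lamF (Ps k v m) k v) m * M) (k + 1)) → W))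
                  (H1k L (fun _ : Fin 4 => NOfLayers (fun m => lamF (Ps k v m) k v) m * M) k φ (η k) (fun _ => (1 : 𝔸ˣ)) hL (αU k v m) (hα1 k v m)
                    (hU1 k v m) (hreg k v m) τ (c₀ := c₀ k) (c₁ := c₁ k) (hαL k v m) (hpos k v m)
                    ((WL2.linearEquiv ℂ ℂ (fun _ : Bond 4 (fun _ : Fin 4 => NOfLayers (fun m => lamF (Ps k v m) k v) m * M) => c₁ k) :
                        BondL2K ℂ 4 (fun _ : Fin 4 => NOfLayers (fun m => lamF (Ps k v m) k v) m * M) (c₁ k) W ≃ₗ[ℂ]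
                          (Bond 4 (fun _ : Fin 4 => NOfLayers (fun m => lamF (Ps k v m) k v) m * M) → W)).symm
                      (Pi.single ((fun i => (⟨((proj (((lamF (Ps k v m) k v).n + 1) * M) x) i).val,
                          ZMod.val_lt ((proj (((lamF (Ps k v m) k v).n + 1) * M) x) i)⟩ : Fin (NOfLayers (fun m => lamF (Ps k v m) k v) m * M))), μ₀) w₀)))) b
              else 0)) atTop (𝓝 (t k v Y x)))
        (_ha : ∀ k v, v ∈ Box γ₀ k → ∀ (Y : LDom 4) (z : Pt 4), A1 k v Y z = (mixedDeriv (Fw k v Y) (t k v Y 0) (t k v Y z)).re),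
      (∃ R : ChainTFac190H 4 M μ ν (oneLoopSplitOfRecord₁₁ F N (θ.toStage11 F N p)) γ₀ (c13OfRecord₁₂ F N θ cR)
          (((c13OfRecord₁₂ F N θ cR).L : ℝ) / 2) α₂ q,
          R.A1 = A1 ∧ ∀ k (v : Fin (k + 1) → ℝ) (hv : v ∈ B12Beta.HistBox γ₀ k),
            (R.leaves k v hv).N = (fun m => (lamF (Ps k v m) k v).n + 1) ∧
              HEq (R.leaves k v hv).W (fun m => (WtOfRecord θ.toStage3Params (lamF (Ps k v m) k v)).toTorusStep)) ∧
        (∀ (_hq : q.Valid (c13OfRecord₁₂ F N θ cR).δ₀) (s : ℝ)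
          (_hsmall : (c13OfRecord₁₂ F N θ cR).ε₁ * remCoeffL 4 M (c13OfRecord₁₂ F N θ cR) α₂ q.B₃ ≤ s)
          (_hcpt : ∀ k (x : Pt 4), ContinuousOn (fun v : Fin (k + 1) → ℝ => limKernel (A1 k v) x) (Box γ₀ k)),
          AtSlopeCont (oneLoopSplitOfRecord₁₁ F N (θ.toStage11 F N p)) γ₀ s) ∧
        (∀ (_hq : q.Valid (c13OfRecord₁₂ F N θ cR).δ₀)
          (_hcpt : ∀ k (x : Pt 4), ContinuousOn (fun v : Fin (k + 1) → ℝ => limKernel (A1 k v) x) (Box γ₀ k)),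
          BetaContH γ₀ (betaOfRecord₁₁ F N (θ.toStage11 F N p))) ∧
        (∀ (_hγ₀ : 0 < γ₀) (_hq : q.Valid (c13OfRecord₁₂ F N θ cR).δ₀) (Lc : ℕ) (Nc : ℝ)
          (_hsmall : (c13OfRecord₁₂ F N θ cR).ε₁ * remCoeffL 4 M (c13OfRecord₁₂ F N θ cR) α₂ q.B₃ ≤ B12Normalization.stepBal Nc Lc)
          (_hcpt : ∀ k (x : Pt 4), ContinuousOn (fun v : Fin (k + 1) → ℝ => limKernel (A1 k v) x) (Box γ₀ k)),
          letI := θ.instVβ₁; letI := θ.instVβ₂; letI := θ.instιβ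
          ∃ γ₁ : ℝ, 0 < γ₁ ∧ γ₁ ≤ θ.γ ∧
            AtSlopeCont
              (oneLoopSplit_betaOfMerged
                (betaMerged F (mergedTermFamilyMatT F N (TcOfRecord F N) (chiFixed7 F N θ.ν) θ.εbg) θ.ρ8 θ.bV)
                (beta0OfMerged (betaMerged F (mergedTermFamilyMatT F N (TcOfRecord F N) (chiFixed7 F N θ.ν) θ.εbg) θ.ρ8 θ.bV) θ.v₀) θ.γ)
              γ₁ (B12Normalization.stepBal Nc Lc)) := by
  -- «Y19»: the thresholds of NE9's structure data, and per (height, volume sequence) the datum with its (4.35) computation rule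
  obtain ⟨δs, Cs, hδs, hCs, HY⟩ :=
    exists_data190_tower_flat (d := 4) (by norm_num) L hL hL3 φ hMφ hMφ' hφ hφ' ha₁ ha₁' τ hτ hCτ hτm hMτ hρw hτ₁ hτ₂ hφτ
      AQ hAQ16
  refine ⟨δs, Cs, hδs, hCs, ?_⟩
  intro η hηL c₀ c₁ _ _ hw hρ M _ I i₀ η₀ L₀ M₀ Rg Hg μ₀ w₀ q δr hδr hσ₀ hcR hκB hδ15 hCst hmw hθ1 γ₀ μ ν α₂ θ p cR lamF hle A1 hm hcF
    hleafF Ps hn hsp h213 hR hC hs αU hα1 hαL hU1 hreg hpos emb hemb hH V instV instVs Fw hFd r hfac t hconv ha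
  -- NODE D per (k, v): «Y19» at height `k` on the members' tori `NOfLayers (m ↦ lamF (Ps k v m) k v)`
  choose D hD using fun (k : ℕ) (v : Fin (k + 1) → ℝ) =>
    HY k (η k) (hηL k) (c₀ k) (c₁ k) (hw k) (hρ k) M (NOfLayers fun m => lamF (Ps k v m) k v) I i₀ η₀ L₀ M₀ Rg Hg μ₀ w₀ q δr hδr
      hσ₀ hcR hκB hδ15 hCst hmw hθ1
  -- the consumer's test-vector limit, transported from the explicit flat vectors to `(D k v).hn` by the computation rule
  have hconv' : ∀ k (v : Fin (k + 1) → ℝ), v ∈ Box γ₀ k → ∀ (Y : LDom 4) (x : Pt 4),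
      Tendsto (fun m => r k v m Y ((D k v).hn m (tproj ((lamF (Ps k v m) k v).n + 1) Y) (proj (((lamF (Ps k v m) k v).n + 1) * M) x)))
        atTop (𝓝 (t k v Y x)) := fun k v hv Y x =>
    (hconv k v hv Y x).congr fun m => by
      rw [hD k v m (tproj ((lamF (Ps k v m) k v).n + 1) Y) (proj (((lamF (Ps k v m) k v).n + 1) * M) x) (αU k v m) (hα1 k v m)
        (hαL k v m) (hU1 k v m) (hreg k v m) (hpos k v m)]
  refine ⟨?_, fun hq s hsmall hcpt => ?_, fun hq hcpt => ?_, fun hγ₀ hq Lc Nc hsmall hcpt => ?_⟩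
  · obtain ⟨R, hA, hNW⟩ := exists_chainTFac190H_view_of_family F N θ p cR lamF hle A1 hm hcF hleafF Ps hn hsp h213 hR hC hs
      (fun k v m => Bond 4 (towerP L (fun _ : Fin 4 => NOfLayers (fun m => lamF (Ps k v m) k v) m * M) (k + 1)) → W) (fun _ _ _ => inferInstance) (fun _ _ _ => inferInstance) emb hemb hH D V instV instVs Fw
      hFd r hfac t hconv' ha
    exact ⟨R, hA, hNW⟩
  · exact atSlopeCont_view_of_family F N θ p cR lamF hle A1 hm hcF hleafF Ps hn hsp h213 hR hC hs
      (fun k v m => Bond 4 (towerP L (fun _ : Fin 4 => NOfLayers (fun m => lamF (Ps k v m) k v) m * M) (k + 1)) → W) (fun _ _ _ => inferInstance) (fun _ _ _ => inferInstance) emb hemb hH D V instV instVs Fw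
      hFd r hfac t hconv' ha hq hsmall hcpt
  · exact betaContH_view_of_family F N θ p cR lamF hle A1 hm hcF hleafF Ps hn hsp h213 hR hC hs
      (fun k v m => Bond 4 (towerP L (fun _ : Fin 4 => NOfLayers (fun m => lamF (Ps k v m) k v) m * M) (k + 1)) → W) (fun _ _ _ => inferInstance) (fun _ _ _ => inferInstance) emb hemb hH D V instV instVs Fw
      hFd r hfac t hconv' ha hq hcpt
  · exact d4AtSlopeOfD1Record12_at_of_family F N θ p cR lamF hle A1 hm hcF hleafF Ps hn hsp h213 hR hC hs
      (fun k v m => Bond 4 (towerP L (fun _ : Fin 4 => NOfLayers (fun m => lamF (Ps k v m) k v) m * M) (k + 1)) → W) (fun _ _ _ => inferInstance) (fun _ _ _ => inferInstance) emb hemb hH D V instV instVs Fw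
      hFd r hfac t hconv' ha hγ₀ hq hsmall hcpt

end FamilyTowerFlat

end Summit.QuantumFields.YangMills.Theorems.BalabanUVNodesN26AtRecord12B13FamilyTowerFlat

end
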